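import Summits.RiemannHypothesis.RiemannHypothesis.Theorems.WeilWindowFlowWindowLipschitzStubCommutatorBound
import Literature.NumberTheory.LFunctions.WeilOddGroundState
import HarnessLib

/-!
# Odd-sector window-Lipschitz, PART 5: the commutator bound `RHS(localised cut) ≤ C·h` for
# odd-sector ground states (pub-rhpf, transport-1, leaf G1.22 'TRANSPORT'; RH-free; def-free)

**mechanism/rigidity campaign; no RH claims.**  Companion text:
`run/shared/lean/pub/pub-rhpf/pub-rhpf-transport-1/TRANSPORT.md` §23 (odd-sector window-Lipschitz).

Odd-sector twin of `WeilWindowFlowWindowLipschitz.stub_commutatorBound` (route WeilWindowFlow, Stub E of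
lines `cut-dont-squeeze` / `borderline-barrier`): from a uniform sup bound (A) and the `L²` edge-mass law
(B) of ODD-SECTOR ground states on `[b₀, A]`, the archimedean and prime commutators plus the polar
remainder of the localised-cut inequality (PART 4) are `≤ C(b₀, A)·h` for admissible cutoffs of width `h`,
and `‖χu‖² ≥ 1/2` (`oddCommutatorBound`); (A) is PART 2, (B) comes from PART 3 in PART 6.  Proof: VERBATIM
the even files (`u`-independent toolkit `…StubCommutatorBoundAux`–`Aux4` imported).
Labels: PROVED tree material only (RH-free); no hypothesis is an open item.  Nothing here is a step toward RH.

References: E. Bombieri, Rend. Mat. Acc. Lincei (9) 11 (2000), §4; Cycon–Froese–Kirsch–Simon (1987), Thm 3.2.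
-/

set_option linter.dupNamespace false  -- D-0017 nested layout: `RiemannHypothesis.RiemannHypothesis`

noncomputable section
open MeasureTheory Set Filter
open scoped Topology ENNReal NNReal

namespace Summit.RiemannHypothesis.RiemannHypothesis.Theorems.OddSectorWindowLipschitz

open Literature.NumberTheory.LFunctions
open Summit.RiemannHypothesis.RiemannHypothesis.Theorems.WeilWindowFlowWindowLipschitz

/-- The commutator bound for a normalised odd-sector ground state (odd twin of
`WeilWindowFlowWindowLipschitz.stub_commutatorBound_core`, verbatim). -/
private theorem oddCommutatorBound_core {u : ℝ → ℂ} {χ : ℝ → ℝ} {a A d₀ KA KB h SA : ℝ}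
    (hum : Measurable u) (hu : IsWeilOddGroundState a u)
    (hu0 : ∀ x, x ∉ Icc (-a) a → u x = 0) (hbd : ∀ x, ‖u x‖ ≤ KA) (hKB : 0 ≤ KB)
    (hd₀ : 0 < d₀) (hd₁ : d₀ ≤ 1 / 4)
    (hB : ∀ r, 0 < r → r ≤ d₀ → ∫ x in {x | a - r < |x|}, ‖u x‖ ^ 2 ≤ KB * r / Real.log (1 / r))
    (haA : a ≤ A)
    (hSA : ∑ n ∈ weilPrimeIndex a, (ArithmeticFunction.vonMangoldt n : ℝ) / Real.sqrt n ≤ SA)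
    (hh : 0 < h) (hhd : 16 * h ≤ d₀) (hhK : 16 * (KB + 1) * h ≤ 1)
    (hχlip : ∀ x y, |χ x - χ y| ≤ |x - y| / h) (hχ01 : ∀ x, 0 ≤ χ x ∧ χ x ≤ 1)
    (hχ1 : ∀ x, |x| ≤ a - 2 * h → χ x = 1) :
    (∫ t in Ioi (0 : ℝ), weilArchDensity t *
          ∫ x, (χ (x + t) - χ x) ^ 2 * (‖u (x + t)‖ * ‖u x‖)) +
      (∑ n ∈ weilPrimeIndex a, (ArithmeticFunction.vonMangoldt n : ℝ) / Real.sqrt n *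
          ∫ x, (χ (x + Real.log n) - χ x) ^ 2 * (‖u (x + Real.log n)‖ * ‖u x‖)) +
      2 * ‖∫ t, ((1 - χ t : ℝ) : ℂ) * u t * (Real.cosh (t / 2) : ℂ)‖ ^ 2 +
      2 * ‖∫ t, u t * (Real.cosh (t / 2) : ℂ)‖ *
          ‖∫ t, (((1 - χ t) ^ 2 : ℝ) : ℂ) * u t * (Real.cosh (t / 2) : ℂ)‖ +
      2 * ‖∫ t, u t * (Real.sinh (t / 2) : ℂ)‖ *
          ‖∫ t, (((1 - χ t) ^ 2 : ℝ) : ℂ) * u t * (Real.sinh (t / 2) : ℂ)‖ ≤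
      (96 * KB + 4 * (9 * (1 + KB) + weilArchDensity (d₀ / 8) * (A + 1 / 2)) * (1 + KB) +
        4 * SA * KA * (1 + KB) + 2 * (2 * Real.cosh (A / 2) * (1 + KB)) ^ 2 +
        4 * (Real.cosh (A / 2) * (A + 1 / 2)) * (2 * Real.cosh (A / 2) * (1 + KB))) * h ∧
    1 / 2 ≤ ∫ x, ‖(χ x : ℂ) * u x‖ ^ 2 := by
  have ha : 0 < a := hu.pos
  have hA : 0 < A := ha.trans_le haA
  have hKA : 0 ≤ KA := (norm_nonneg _).trans (hbd 0)
  have hui : Integrable u := hu.integrable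
  have hu2 : Integrable fun x ↦ ‖u x‖ ^ 2 :=
    (memLp_two_iff_integrable_sq_norm hu.memLp.1).1 hu.memLp
  have hnorm : ∫ x, ‖u x‖ ^ 2 = 1 := hu.integral_norm_sq
  have hh1 : h ≤ 1 := by
    have : 1 * h ≤ 16 * (KB + 1) * h := mul_le_mul_of_nonneg_right (by linarith) hh.le
    linarith
  -- simplified edge-mass law `∫_{a-r<|x|} |u|² ≤ KB r`
  have hB1 : ∀ r, 0 < r → r ≤ d₀ → ∫ x in {x | a - r < |x|}, ‖u x‖ ^ 2 ≤ KB * r := by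
    intro r hr hrd
    have hl : 1 ≤ Real.log (1 / r) := by
      have hq : Real.exp 1 ≤ 1 / r := by
        rw [le_div_iff₀ hr]
        calc Real.exp 1 * r ≤ 2.7182818286 * (1 / 4) :=
              mul_le_mul Real.exp_one_lt_d9.le (hrd.trans hd₁) hr.le (by norm_num)
          _ ≤ 1 := by norm_num
      simpa using Real.log_le_log (Real.exp_pos 1) hq
    calc _ ≤ KB * r / Real.log (1 / r) := hB r hr hrd
      _ ≤ KB * r / 1 := div_le_div_of_nonneg_left (by positivity) one_pos hl
      _ = KB * r := div_one _
  -- the dyadic index `J`: `2^J ≤ d₀/(4h) < 2^(J+1)`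
  obtain ⟨J, hJ1, hJ2⟩ := exists_nat_pow_near (x := d₀ / (4 * h)) (y := (2 : ℝ))
    (by rw [le_div_iff₀ (by positivity)]; linarith) one_lt_two
  have hJa : 2 ^ (J + 2) * h ≤ d₀ := by
    have := (le_div_iff₀ (by positivity : (0 : ℝ) < 4 * h)).1 hJ1
    calc (2 : ℝ) ^ (J + 2) * h = 2 ^ J * (4 * h) := by ring
      _ ≤ d₀ := this
  have hJb : d₀ < 2 ^ (J + 3) * h := by
    have := (div_lt_iff₀ (by positivity : (0 : ℝ) < 4 * h)).1 hJ2
    calc d₀ < 2 ^ (J + 1) * (4 * h) := this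
      _ = 2 ^ (J + 3) * h := by ring
  have hJge : 1 ≤ J := by
    by_contra hJ0
    rw [not_le, Nat.lt_one_iff] at hJ0
    subst hJ0
    have : (4 : ℝ) ≤ d₀ / (4 * h) := by
      rw [le_div_iff₀ (by positivity)]
      linarith
    norm_num at hJ2
    linarith
  have hJpow : (2 : ℝ) ^ J ≤ 1 / (2 * h) := by
    calc (2 : ℝ) ^ J ≤ d₀ / (4 * h) := hJ1
      _ ≤ 1 / (2 * h) := by
          rw [div_le_div_iff₀ (by positivity) (by positivity)]
          have : d₀ * (2 * h) ≤ 2 * (2 * h) := mul_le_mul_of_nonneg_right (by linarith) (by positivity)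
          linarith
  have hsqrtJ : 1 ≤ Real.sqrt J := Real.one_le_sqrt.2 (by exact_mod_cast hJge)
  have hsqrtJpos : 0 < Real.sqrt J := by linarith
  -- the layer mass `Bf`
  set L2 := {x : ℝ | a - 2 * h < |x|} with hL2
  have hL2m : MeasurableSet L2 := stub_commutatorBound_measurableSet_layer a _
  set Bf := ∫ x in L2, ‖u x‖ with hBf
  have hBf0 : 0 ≤ Bf := integral_nonneg fun x ↦ norm_nonneg _
  have hBfle : Bf ≤ 2 * (1 + KB) * h / Real.sqrt J :=
    stub_commutatorBound_layer_le hu2 hKB hB hu0 hh (by linarith) hJge hJpow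
  have hBfle' : Bf ≤ 2 * (1 + KB) * h := hBfle.trans (div_le_self (by positivity) hsqrtJ)
  have hf0 : ∀ x, 0 ≤ L2.indicator (fun x ↦ ‖u x‖) x :=
    fun x ↦ indicator_nonneg (fun _ _ ↦ norm_nonneg _) x
  have hfb : ∀ y, a - |y| < 2 * h → ‖u y‖ ≤ L2.indicator (fun x ↦ ‖u x‖) y := fun y hy ↦ by
    rw [indicator_of_mem (show y ∈ L2 by show a - 2 * h < |y|; linarith)]
  have hfi : Integrable (L2.indicator fun x ↦ ‖u x‖) := hui.norm.indicator hL2m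
  have hintf : ∫ x, L2.indicator (fun x ↦ ‖u x‖) x = Bf := integral_indicator hL2m
  -- `‖u‖₁ ≤ A + 1/2`
  have hL1 : ∫ x, ‖u x‖ ≤ A + 1 / 2 := by
    have := stub_commutatorBound_norm_one_le ha.le hu0 hu2
    rw [hnorm] at this
    linarith
  have hL1nn : 0 ≤ ∫ x, ‖u x‖ := integral_nonneg fun x ↦ norm_nonneg _
  -- (1) the archimedean term
  set CV := 9 * (1 + KB) + weilArchDensity (d₀ / 8) * (A + 1 / 2) with hCV
  have hρ8 : 0 < weilArchDensity (d₀ / 8) := weilArchDensity_pos (by positivity)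
  have hCV0 : 0 ≤ CV := by positivity
  have hBV : (1 + KB) + 8 * (1 + KB) * Real.sqrt J + weilArchDensity (d₀ / 8) * ∫ x, ‖u x‖ ≤
      CV * Real.sqrt J := by
    have h1 : (1 + KB) ≤ (1 + KB) * Real.sqrt J := le_mul_of_one_le_right (by positivity) hsqrtJ
    have h2 : weilArchDensity (d₀ / 8) * (∫ x, ‖u x‖) ≤
        weilArchDensity (d₀ / 8) * (A + 1 / 2) * Real.sqrt J :=
      calc _ ≤ weilArchDensity (d₀ / 8) * (A + 1 / 2) := mul_le_mul_of_nonneg_left hL1 hρ8.le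
        _ ≤ _ := le_mul_of_one_le_right (by positivity) hsqrtJ
    calc _ ≤ (1 + KB) * Real.sqrt J + 8 * (1 + KB) * Real.sqrt J +
          weilArchDensity (d₀ / 8) * (A + 1 / 2) * Real.sqrt J := by linarith
      _ = CV * Real.sqrt J := by rw [hCV]; ring
  have hT1 : ∫ t in Ioi (0 : ℝ), weilArchDensity t *
        ∫ x, (χ (x + t) - χ x) ^ 2 * (‖u (x + t)‖ * ‖u x‖) ≤
      96 * KB * h + 4 * CV * (1 + KB) * h := by
    have hm6 : ∫ x in {x | a - 6 * h < |x|}, ‖u x‖ ^ 2 ≤ KB * (6 * h) :=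
      hB1 _ (by positivity) (by linarith)
    have hBV0 : 0 ≤ (1 + KB) + 8 * (1 + KB) * Real.sqrt J +
        weilArchDensity (d₀ / 8) * ∫ x, ‖u x‖ := by positivity
    have hprod : ((1 + KB) + 8 * (1 + KB) * Real.sqrt J + weilArchDensity (d₀ / 8) * ∫ x, ‖u x‖) *
        Bf ≤ (CV * Real.sqrt J) * (2 * (1 + KB) * h / Real.sqrt J) :=
      mul_le_mul hBV hBfle hBf0 (by positivity)
    have heq : (CV * Real.sqrt J) * (2 * (1 + KB) * h / Real.sqrt J) = 2 * CV * (1 + KB) * h := by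
      field_simp
    calc _ ≤ 16 * (∫ x in {x | a - 6 * h < |x|}, ‖u x‖ ^ 2) +
          2 * ((1 + KB) + 8 * (1 + KB) * Real.sqrt J + weilArchDensity (d₀ / 8) * ∫ x, ‖u x‖) *
            Bf :=
          stub_commutatorBound_arch_concrete hum hui hu2 hKB hd₀ hd₁ hB hu0 hh J hJa hJb hχlip
            hχ01 hχ1
      _ ≤ 16 * (KB * (6 * h)) + 2 * ((CV * Real.sqrt J) * (2 * (1 + KB) * h / Real.sqrt J)) := by
          have hprod2 := mul_le_mul_of_nonneg_left hprod zero_le_two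
          rw [← mul_assoc] at hprod2
          linarith
      _ = 96 * KB * h + 4 * CV * (1 + KB) * h := by rw [heq]; ring
  -- (2) the prime terms
  have hT2 : ∑ n ∈ weilPrimeIndex a, (ArithmeticFunction.vonMangoldt n : ℝ) / Real.sqrt n *
        ∫ x, (χ (x + Real.log n) - χ x) ^ 2 * (‖u (x + Real.log n)‖ * ‖u x‖) ≤
      SA * (4 * KA * (1 + KB) * h) := by
    have hterm : ∀ n ∈ weilPrimeIndex a,
        (ArithmeticFunction.vonMangoldt n : ℝ) / Real.sqrt n *
          ∫ x, (χ (x + Real.log n) - χ x) ^ 2 * (‖u (x + Real.log n)‖ * ‖u x‖) ≤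
        (ArithmeticFunction.vonMangoldt n : ℝ) / Real.sqrt n * (4 * KA * (1 + KB) * h) := by
      intro n _
      refine mul_le_mul_of_nonneg_left ?_
        (div_nonneg ArithmeticFunction.vonMangoldt_nonneg (Real.sqrt_nonneg _))
      calc _ ≤ 2 * KA * ∫ x, L2.indicator (fun x ↦ ‖u x‖) x :=
            stub_commutatorBound_prime_le hχ01 hχ1 hbd hf0 hfb hfi (Real.log n)
        _ = 2 * KA * Bf := by rw [hintf]
        _ ≤ 2 * KA * (2 * (1 + KB) * h) := by gcongr
        _ = 4 * KA * (1 + KB) * h := by ring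
    calc _ ≤ ∑ n ∈ weilPrimeIndex a, (ArithmeticFunction.vonMangoldt n : ℝ) / Real.sqrt n *
          (4 * KA * (1 + KB) * h) := Finset.sum_le_sum hterm
      _ = (∑ n ∈ weilPrimeIndex a, (ArithmeticFunction.vonMangoldt n : ℝ) / Real.sqrt n) *
          (4 * KA * (1 + KB) * h) := (Finset.sum_mul _ _ _).symm
      _ ≤ SA * (4 * KA * (1 + KB) * h) := mul_le_mul_of_nonneg_right hSA (by positivity)
  -- (3) the pole terms
  set M := Real.cosh (A / 2) with hMdef
  have hM : 0 ≤ M := (Real.cosh_pos _).le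
  have hwc : ∀ x, |x| ≤ a → |Real.cosh (x / 2)| ≤ M :=
    fun x hx ↦ (stub_commutatorBound_cosh_sinh_le haA hx).1
  have hws : ∀ x, |x| ≤ a → |Real.sinh (x / 2)| ≤ M :=
    fun x hx ↦ (stub_commutatorBound_cosh_sinh_le haA hx).2
  have hθ1 : ∀ x, |1 - χ x| ≤ 1 :=
    fun x ↦ abs_le.2 ⟨by linarith [(hχ01 x).2], by linarith [(hχ01 x).1]⟩
  have hθ2 : ∀ x, |(1 - χ x) ^ 2| ≤ 1 := fun x ↦ by
    rw [abs_pow]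
    calc |1 - χ x| ^ 2 ≤ 1 ^ 2 := pow_le_pow_left₀ (abs_nonneg _) (hθ1 x) 2
      _ = 1 := one_pow 2
  have hθ10 : ∀ x, |x| ≤ a - 2 * h → 1 - χ x = 0 := fun x hx ↦ by rw [hχ1 x hx, sub_self]
  have hθ20 : ∀ x, |x| ≤ a - 2 * h → (1 - χ x) ^ 2 = 0 := fun x hx ↦ by
    rw [hθ10 x hx]
    norm_num
  have hP1 : ‖∫ t, ((1 - χ t : ℝ) : ℂ) * u t * (Real.cosh (t / 2) : ℂ)‖ ≤ M * Bf := by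
    have := stub_commutatorBound_pole_le (θ := fun t ↦ 1 - χ t) (w := fun t ↦ Real.cosh (t / 2))
      hu0 hθ1 hθ10 hf0 hfb hfi hM hwc
    rwa [hintf] at this
  have hP2 : ‖∫ t, (((1 - χ t) ^ 2 : ℝ) : ℂ) * u t * (Real.cosh (t / 2) : ℂ)‖ ≤ M * Bf := by
    have := stub_commutatorBound_pole_le (θ := fun t ↦ (1 - χ t) ^ 2)
      (w := fun t ↦ Real.cosh (t / 2)) hu0 hθ2 hθ20 hf0 hfb hfi hM hwc
    rwa [hintf] at this
  have hP3 : ‖∫ t, (((1 - χ t) ^ 2 : ℝ) : ℂ) * u t * (Real.sinh (t / 2) : ℂ)‖ ≤ M * Bf := by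
    have := stub_commutatorBound_pole_le (θ := fun t ↦ (1 - χ t) ^ 2)
      (w := fun t ↦ Real.sinh (t / 2)) hu0 hθ2 hθ20 hf0 hfb hfi hM hws
    rwa [hintf] at this
  have hQ1 : ‖∫ t, u t * (Real.cosh (t / 2) : ℂ)‖ ≤ M * (A + 1 / 2) :=
    (stub_commutatorBound_pairing_le (w := fun t ↦ Real.cosh (t / 2)) hu0 hui hwc).trans
      (mul_le_mul_of_nonneg_left hL1 hM)
  have hQ2 : ‖∫ t, u t * (Real.sinh (t / 2) : ℂ)‖ ≤ M * (A + 1 / 2) :=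
    (stub_commutatorBound_pairing_le (w := fun t ↦ Real.sinh (t / 2)) hu0 hui hws).trans
      (mul_le_mul_of_nonneg_left hL1 hM)
  have hPle : M * Bf ≤ 2 * M * (1 + KB) * h := by
    calc M * Bf ≤ M * (2 * (1 + KB) * h) := mul_le_mul_of_nonneg_left hBfle' hM
      _ = 2 * M * (1 + KB) * h := by ring
  have hT3 : 2 * ‖∫ t, ((1 - χ t : ℝ) : ℂ) * u t * (Real.cosh (t / 2) : ℂ)‖ ^ 2 ≤
      2 * (2 * M * (1 + KB)) ^ 2 * h := by
    have h1 : ‖∫ t, ((1 - χ t : ℝ) : ℂ) * u t * (Real.cosh (t / 2) : ℂ)‖ ≤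
        2 * M * (1 + KB) * h := hP1.trans hPle
    have h2 : ‖∫ t, ((1 - χ t : ℝ) : ℂ) * u t * (Real.cosh (t / 2) : ℂ)‖ ^ 2 ≤
        (2 * M * (1 + KB) * h) ^ 2 := pow_le_pow_left₀ (norm_nonneg _) h1 2
    have h3 : (2 * M * (1 + KB) * h) ^ 2 ≤ (2 * M * (1 + KB)) ^ 2 * h := by
      have : h ^ 2 ≤ h := by
        calc h ^ 2 = h * h := sq h
          _ ≤ 1 * h := mul_le_mul_of_nonneg_right hh1 hh.le
          _ = h := one_mul h
      calc (2 * M * (1 + KB) * h) ^ 2 = (2 * M * (1 + KB)) ^ 2 * h ^ 2 := by ring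
        _ ≤ (2 * M * (1 + KB)) ^ 2 * h := mul_le_mul_of_nonneg_left this (by positivity)
    linarith
  have hT4 : 2 * ‖∫ t, u t * (Real.cosh (t / 2) : ℂ)‖ *
        ‖∫ t, (((1 - χ t) ^ 2 : ℝ) : ℂ) * u t * (Real.cosh (t / 2) : ℂ)‖ ≤
      2 * (M * (A + 1 / 2)) * (2 * M * (1 + KB) * h) :=
    mul_le_mul (mul_le_mul_of_nonneg_left hQ1 zero_le_two) (hP2.trans hPle) (norm_nonneg _)
      (by positivity)
  have hT5 : 2 * ‖∫ t, u t * (Real.sinh (t / 2) : ℂ)‖ *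
        ‖∫ t, (((1 - χ t) ^ 2 : ℝ) : ℂ) * u t * (Real.sinh (t / 2) : ℂ)‖ ≤
      2 * (M * (A + 1 / 2)) * (2 * M * (1 + KB) * h) :=
    mul_le_mul (mul_le_mul_of_nonneg_left hQ2 zero_le_two) (hP3.trans hPle) (norm_nonneg _)
      (by positivity)
  refine ⟨?_, ?_⟩
  · -- assembly
    have hsum := add_le_add (add_le_add (add_le_add (add_le_add hT1 hT2) hT3) hT4) hT5
    refine hsum.trans (le_of_eq ?_)
    rw [hCV]
    ring
  · -- (4) the mass of the cut state
    have hχc : Continuous χ := by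
      refine (LipschitzWith.of_dist_le_mul (K := Real.toNNReal (1 / h)) fun x y ↦ ?_).continuous
      rw [Real.dist_eq, Real.dist_eq, Real.coe_toNNReal _ (by positivity)]
      calc |χ x - χ y| ≤ |x - y| / h := hχlip x y
        _ = 1 / h * |x - y| := by ring
    have hmass := stub_commutatorBound_mass_ge hu.memLp.1 hu2 hχc hχ01 hχ1
    rw [hnorm] at hmass
    have hm2 : ∫ x in {x | a - 2 * h < |x|}, ‖u x‖ ^ 2 ≤ KB * (2 * h) :=
      hB1 _ (by positivity) (by linarith)
    have : KB * (2 * h) ≤ 1 / 2 := by linarith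
    linarith

/-- Normalisation of an odd-sector ground state: an odd-sector ground state `u` of the window `a` with `‖u‖ ≤ K` a.e. has an
a.e.-equal MEASURABLE modification `ũ` vanishing pointwise off `[−a, a]` and bounded pointwise by
`max K 0`. [folklore] -/
private theorem oddCommutatorBound_normalise {a K : ℝ} {u : ℝ → ℂ} (hu : IsWeilOddGroundState a u)
    (hK : ∀ᵐ x : ℝ, ‖u x‖ ≤ K) :
    ∃ v : ℝ → ℂ, Measurable v ∧ v =ᵐ[volume] u ∧ (∀ x, x ∉ Icc (-a) a → v x = 0) ∧
      ∀ x, ‖v x‖ ≤ max K 0 := by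
  set u₁ : ℝ → ℂ := hu.memLp.1.mk u with hu₁
  have hu₁m : Measurable u₁ := hu.memLp.1.stronglyMeasurable_mk.measurable
  have hu₁ae : u =ᵐ[volume] u₁ := hu.memLp.1.ae_eq_mk
  set S : Set ℝ := {x | ‖u₁ x‖ ≤ max K 0} ∩ Icc (-a) a with hS
  have hSm : MeasurableSet S :=
    (measurableSet_le hu₁m.norm measurable_const).inter measurableSet_Icc
  refine ⟨S.indicator u₁, hu₁m.indicator hSm, ?_, ?_, ?_⟩
  · filter_upwards [hu₁ae, hK, hu.ae_eq_zero_of_notMem] with x hx hxK hx0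
    by_cases hxI : x ∈ Icc (-a) a
    · have hxS : x ∈ S := ⟨by show ‖u₁ x‖ ≤ max K 0; rw [← hx]; exact hxK.trans (le_max_left _ _), hxI⟩
      rw [indicator_of_mem hxS, hx]
    · have hxS : x ∉ S := fun h ↦ hxI h.2
      rw [indicator_of_notMem hxS, hx0 hxI]
  · intro x hx
    exact indicator_of_notMem (fun h ↦ hx h.2) _
  · intro x
    by_cases hxS : x ∈ S
    · rw [indicator_of_mem hxS]
      exact hxS.1
    · rw [indicator_of_notMem hxS, norm_zero]
      exact le_max_right _ _

/-- **The commutator bound for odd-sector ground states** (odd twin of Stub E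
`WeilWindowFlowWindowLipschitz.stub_commutatorBound`; same hypotheses (A) sup bound, (B) `L²` edge-mass
law, now quantified over `IsWeilOddGroundState`).  From (A) and (B) on a compact window range `[b₀, A]`:
for every window `a ∈ [b₀, A]`, width `0 < h ≤ h₀`, odd-sector ground state `u` and admissible cutoff `χ`
(values in `[0,1]`, `= 1` on `|x| ≤ a − 2h`, `= 0` on `|x| ≥ a − h`, slope `≤ 1/h`), the right-hand side
of the localised-cut inequality is `≤ C(b₀, A) · h` and `‖χu‖² ≥ 1/2`.  Proof: verbatim the even stub
(the `u`-independent toolkit `…StubCommutatorBoundAux…Aux4` is imported; the core bound is re-run for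
`IsWeilOddGroundState`, which it touches only through `pos`, `memLp`, `integrable`, `integral_norm_sq`).
[cite: Bombieri2000Weil, §4] -/
theorem oddCommutatorBound :
    (∀ b₀ A : ℝ, 0 < b₀ → b₀ ≤ A → ∃ K : ℝ, ∀ (a : ℝ) (u : ℝ → ℂ), b₀ ≤ a → a ≤ A →
      IsWeilOddGroundState a u → ∀ᵐ x : ℝ, ‖u x‖ ≤ K) →
    (∀ b₀ A : ℝ, 0 < b₀ → b₀ ≤ A → ∃ K d₀ : ℝ, 0 < d₀ ∧ d₀ < 1 ∧
      ∀ (a r : ℝ) (u : ℝ → ℂ), b₀ ≤ a → a ≤ A → IsWeilOddGroundState a u → 0 < r → r ≤ d₀ →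
        ∫ x in {x : ℝ | a - r < |x|}, ‖u x‖ ^ 2 ≤ K * r / Real.log (1 / r)) →
    ∀ b₀ A : ℝ, 0 < b₀ → b₀ ≤ A → ∃ C h₀ : ℝ, 0 < h₀ ∧
        ∀ (a h : ℝ) (u : ℝ → ℂ) (χ : ℝ → ℝ), b₀ ≤ a → a ≤ A → 0 < h → h ≤ h₀ →
        IsWeilOddGroundState a u → (∀ x y, |χ x - χ y| ≤ |x - y| / h) → (∀ x, 0 ≤ χ x ∧ χ x ≤ 1) →
        (∀ x, |x| ≤ a - 2 * h → χ x = 1) → (∀ x, a - h ≤ |x| → χ x = 0) →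
        (∫ t in Ioi (0 : ℝ), weilArchDensity t *
              ∫ x, (χ (x + t) - χ x) ^ 2 * (‖u (x + t)‖ * ‖u x‖)) +
          (∑ n ∈ weilPrimeIndex a, (ArithmeticFunction.vonMangoldt n : ℝ) / Real.sqrt n *
              ∫ x, (χ (x + Real.log n) - χ x) ^ 2 * (‖u (x + Real.log n)‖ * ‖u x‖)) +
          2 * ‖∫ t, ((1 - χ t : ℝ) : ℂ) * u t * (Real.cosh (t / 2) : ℂ)‖ ^ 2 +
          2 * ‖∫ t, u t * (Real.cosh (t / 2) : ℂ)‖ *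
              ‖∫ t, (((1 - χ t) ^ 2 : ℝ) : ℂ) * u t * (Real.cosh (t / 2) : ℂ)‖ +
          2 * ‖∫ t, u t * (Real.sinh (t / 2) : ℂ)‖ *
              ‖∫ t, (((1 - χ t) ^ 2 : ℝ) : ℂ) * u t * (Real.sinh (t / 2) : ℂ)‖ ≤ C * h ∧
          1 / 2 ≤ ∫ x, ‖(χ x : ℂ) * u x‖ ^ 2 := by
  intro hA hB b₀ A hb₀ hbA
  obtain ⟨KA, hKA⟩ := hA b₀ A hb₀ hbA
  obtain ⟨KB, d₀, hd₀, hd₀1, hKB⟩ := hB b₀ A hb₀ hbA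
  set KA' : ℝ := max KA 0 with hKA'
  set KB' : ℝ := max KB 0 with hKB'
  set d₁ : ℝ := min d₀ (1 / 4) with hd₁
  set SA : ℝ := ∑ n ∈ weilPrimeIndex A, (ArithmeticFunction.vonMangoldt n : ℝ) / Real.sqrt n
    with hSAdef
  have hKB'0 : 0 ≤ KB' := le_max_right _ _
  have hd₁0 : 0 < d₁ := lt_min hd₀ (by norm_num)
  have hd₁4 : d₁ ≤ 1 / 4 := min_le_right _ _
  have hd₁d₀ : d₁ ≤ d₀ := min_le_left _ _
  set C : ℝ := 96 * KB' + 4 * (9 * (1 + KB') + weilArchDensity (d₁ / 8) * (A + 1 / 2)) * (1 + KB') +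
      4 * SA * KA' * (1 + KB') + 2 * (2 * Real.cosh (A / 2) * (1 + KB')) ^ 2 +
      4 * (Real.cosh (A / 2) * (A + 1 / 2)) * (2 * Real.cosh (A / 2) * (1 + KB')) with hCdef
  set h₀ : ℝ := min (d₁ / 16) (1 / (16 * (KB' + 1))) with hh₀
  have hh₀pos : 0 < h₀ := lt_min (by positivity) (by positivity)
  refine ⟨C, h₀, hh₀pos, ?_⟩
  intro a h u χ hba haA hh hhh₀ hu hχlip hχ01 hχ1 _hχ0
  have hhd : 16 * h ≤ d₁ := by
    have : h ≤ d₁ / 16 := hhh₀.trans (min_le_left _ _)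
    linarith
  have hhK : 16 * (KB' + 1) * h ≤ 1 := by
    have h1 : h ≤ 1 / (16 * (KB' + 1)) := hhh₀.trans (min_le_right _ _)
    rw [le_div_iff₀ (by positivity)] at h1
    linarith
  -- normalise `u`
  obtain ⟨v, hvm, hvu, hv0, hvb⟩ := oddCommutatorBound_normalise hu (hKA a u hba haA hu)
  have hgs : IsWeilOddGroundState a v := hu.congr_ae hvu.symm
  -- the edge-mass law for `v` with constant `KB'` on `(0, d₁]`
  have hBv : ∀ r, 0 < r → r ≤ d₁ →
      ∫ x in {x | a - r < |x|}, ‖v x‖ ^ 2 ≤ KB' * r / Real.log (1 / r) := by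
    intro r hr hrd
    have hrd₀ : r ≤ d₀ := hrd.trans hd₁d₀
    have heq : ∫ x in {x | a - r < |x|}, ‖v x‖ ^ 2 = ∫ x in {x | a - r < |x|}, ‖u x‖ ^ 2 :=
      integral_congr_ae (ae_restrict_of_ae (hvu.mono fun x hx ↦ by simp only [hx]))
    rw [heq]
    have hlog : 0 < Real.log (1 / r) := Real.log_pos (by
      rw [lt_div_iff₀ hr]; linarith [hrd₀.trans_lt hd₀1])
    calc _ ≤ KB * r / Real.log (1 / r) := hKB a r u hba haA hu hr hrd₀
      _ ≤ KB' * r / Real.log (1 / r) :=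
          div_le_div_of_nonneg_right (mul_le_mul_of_nonneg_right (le_max_left _ _) hr.le) hlog.le
  have hSA : ∑ n ∈ weilPrimeIndex a, (ArithmeticFunction.vonMangoldt n : ℝ) / Real.sqrt n ≤ SA :=
    Finset.sum_le_sum_of_subset_of_nonneg (stub_supBound_weilPrimeIndex_mono haA)
      (fun n _ _ ↦ div_nonneg ArithmeticFunction.vonMangoldt_nonneg (Real.sqrt_nonneg _))
  have hcore := oddCommutatorBound_core hvm hgs hv0 hvb hKB'0 hd₁0 hd₁4 hBv haA hSA hh hhd hhK
    hχlip hχ01 hχ1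
  -- transport the six integrals from `v` back to `u`
  have hsh : ∀ s : ℝ, (fun x ↦ v (x + s)) =ᵐ[volume] fun x ↦ u (x + s) := fun s ↦
    (measurePreserving_add_right volume s).quasiMeasurePreserving.ae_eq_comp hvu
  have e1 : ∀ s : ℝ, ∫ x, (χ (x + s) - χ x) ^ 2 * (‖v (x + s)‖ * ‖v x‖) =
      ∫ x, (χ (x + s) - χ x) ^ 2 * (‖u (x + s)‖ * ‖u x‖) := by
    intro s
    refine integral_congr_ae ?_
    filter_upwards [hvu, hsh s] with x hx hxs
    simp only [hx, hxs]
  have e3 : ∀ w : ℝ → ℂ, ∫ t, w t * v t * (Real.cosh (t / 2) : ℂ) =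
      ∫ t, w t * u t * (Real.cosh (t / 2) : ℂ) := fun w ↦
    integral_congr_ae (hvu.mono fun x hx ↦ by simp only [hx])
  have e4 : ∀ w : ℝ → ℂ, ∫ t, w t * v t * (Real.sinh (t / 2) : ℂ) =
      ∫ t, w t * u t * (Real.sinh (t / 2) : ℂ) := fun w ↦
    integral_congr_ae (hvu.mono fun x hx ↦ by simp only [hx])
  have e5 : ∫ t, v t * (Real.cosh (t / 2) : ℂ) = ∫ t, u t * (Real.cosh (t / 2) : ℂ) :=
    integral_congr_ae (hvu.mono fun x hx ↦ by simp only [hx])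
  have e6 : ∫ t, v t * (Real.sinh (t / 2) : ℂ) = ∫ t, u t * (Real.sinh (t / 2) : ℂ) :=
    integral_congr_ae (hvu.mono fun x hx ↦ by simp only [hx])
  have e7 : ∫ x, ‖(χ x : ℂ) * v x‖ ^ 2 = ∫ x, ‖(χ x : ℂ) * u x‖ ^ 2 :=
    integral_congr_ae (hvu.mono fun x hx ↦ by simp only [hx])
  simp only [e1, e3, e4, e5, e6, e7] at hcore
  exact hcore

end Summit.RiemannHypothesis.RiemannHypothesis.Theorems.OddSectorWindowLipschitz

end
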